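import Summits.ValiantsHypothesis.ValiantsHypothesis.Theorems.BinomialElusivePeelingLemmaFewSlots

/-!
# Four slots on an interior arm (all-X designs against `BinomialElusive.PeelingLemma`)

Helper for the crux stmt-ValiantsHypothesis-7391 (negative lane; `Cruxes/PeelingLemma/DETERMINISTIC-ALLX.md`
§3b, Case I of the gadget-level local lemma [E]).  Along one arm, edge `k` joins position `k` to
`k+1` and carries the two output multiplicities `u k`, `u' k` of a relation; the charges at position
`t` are `c¹ t = u t + u' (t-1)` and `c² t = u' t + u (t-1)` (Lemma B), and `D t = u (t-1) - u' (t-1)`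
is a potential with `D (t+1) - D t = c¹ t - c² t` (BALANCE) and `Σ |D| ≤ cost`.  If the arm carries a
nonzero part of the relation of cost `< 4q`, then (`arm_four_slots`) there are four distinct
(side, position) slots — positions `τ` in the letter window `[a - 2q, b + 1]` of the charged edges
`[a, b]` whose letter `f τ` has a nonzero coefficient on that side: two per side if both sides are
charged (`two_slots`), four on one side otherwise (`four_slots_of_potential`).  When the window
consists of private letters of the arm (interior arm), these are four support letters of the
gadget's charge vector.  Pure combinatorics; no Theses import.
-/

namespace Summit.ValiantsHypothesis.ValiantsHypothesis.Theorems.PeelingLemmaWindow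

-- summit = sub-problem name (single-conjunct summit, D-0017 layout), so the namespace repeats it
set_option linter.dupNamespace false

open scoped BigOperators
open Finset

variable {Λ : Type*} [DecidableEq Λ]

/-- A letter outside the window `[t₀ - 2q, t₁]` of a charge configuration on `[t₀, t₁]` has
coefficient `0`. -/
theorem charge_sum_apply_born_eq_zero {f : ℤ → Λ} (hf : Function.Injective f) (q : ℕ) (c : ℤ → ℤ)
    (t₀ t₁ τ : ℤ) (hτ : τ + 2 * q < t₀ ∨ t₁ < τ) :
    ∑ t ∈ Finset.Icc t₀ t₁, c t * win f q t (f τ) = 0 := by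
  rw [charge_sum_apply_born hf]
  refine Finset.sum_eq_zero fun t ht => ?_
  obtain ⟨ht1, ht2, ht3⟩ := Finset.mem_filter.mp ht
  obtain ⟨h1, h2⟩ := Finset.mem_Icc.mp ht1
  omega

/-- Restricting a charge sum to the support hull of the charges. -/
theorem charge_sum_restrict {f : ℤ → Λ} (q : ℕ) (c : ℤ → ℤ) {a b t₀ t₁ : ℤ} (ha : a ≤ t₀)
    (hb : t₁ ≤ b) (hout : ∀ t, a ≤ t → t ≤ b → (t < t₀ ∨ t₁ < t) → c t = 0) (ν : Λ) :
    ∑ t ∈ Finset.Icc a b, c t * win f q t ν = ∑ t ∈ Finset.Icc t₀ t₁, c t * win f q t ν := by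
  symm
  refine Finset.sum_subset (Finset.Icc_subset_Icc ha hb) fun t ht hnt => ?_
  obtain ⟨h1, h2⟩ := Finset.mem_Icc.mp ht
  rw [Finset.mem_Icc, not_and_or, not_le, not_le] at hnt
  rw [hout t h1 h2 (by omega), zero_mul]

/-- **Four slots on an arm.**  Edges `k ∈ [a, b]` of one arm carry multiplicities `u k, u' k`
(zero outside), not all zero, of total cost `< 4q` (`q ≥ 2`).  With the charges
`c¹ t = u t + u' (t-1)`, `c² t = u' t + u (t-1)` there are four distinct slots `(side, τ)`,
`τ ∈ [a - 2q, b + 1]`, such that the letter `f τ` has a nonzero coefficient in the side's charge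
combination `Σ_{t ∈ [a, b+1]} c t · win f q t`. -/
theorem arm_four_slots {f : ℤ → Λ} (hf : Function.Injective f) (q : ℕ) (hq : 2 ≤ q)
    (u u' : ℤ → ℤ) (a b : ℤ)
    (hu : ∀ k, k < a ∨ b < k → u k = 0) (hu' : ∀ k, k < a ∨ b < k → u' k = 0)
    (hne : ∃ k, u k ≠ 0 ∨ u' k ≠ 0)
    (hcost : ∑ k ∈ Finset.Icc a b, (|u k| + |u' k|) < 4 * q) :
    ∃ T : Finset (Bool × ℤ), T.card = 4 ∧ ∀ x ∈ T, (a - 2 * q ≤ x.2 ∧ x.2 ≤ b + 1) ∧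
      (if x.1 then ∑ t ∈ Finset.Icc a (b + 1), (u t + u' (t - 1)) * win f q t (f x.2) ≠ 0
        else ∑ t ∈ Finset.Icc a (b + 1), (u' t + u (t - 1)) * win f q t (f x.2) ≠ 0) := by
  classical
  -- the two charge functions and their supports inside [a, b+1]
  set c₁ : ℤ → ℤ := fun t => u t + u' (t - 1) with hc₁
  set c₂ : ℤ → ℤ := fun t => u' t + u (t - 1) with hc₂
  have hc₁out : ∀ t, t < a ∨ b + 1 < t → c₁ t = 0 := by
    intro t ht; simp only [hc₁]; rw [hu t (by omega), hu' (t - 1) (by omega), add_zero]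
  have hc₂out : ∀ t, t < a ∨ b + 1 < t → c₂ t = 0 := by
    intro t ht; simp only [hc₂]; rw [hu' t (by omega), hu (t - 1) (by omega), add_zero]
  let S₁ := (Finset.Icc a (b + 1)).filter (fun t => c₁ t ≠ 0)
  let S₂ := (Finset.Icc a (b + 1)).filter (fun t => c₂ t ≠ 0)
  -- not both charge functions vanish
  have hS : S₁.Nonempty ∨ S₂.Nonempty := by
    by_contra h
    rw [not_or, Finset.not_nonempty_iff_eq_empty, Finset.not_nonempty_iff_eq_empty] at h
    have h1 : ∀ t, c₁ t = 0 := by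
      intro t
      by_cases ht : a ≤ t ∧ t ≤ b + 1
      · by_contra hct
        have : t ∈ S₁ := Finset.mem_filter.mpr ⟨Finset.mem_Icc.mpr ht, hct⟩
        rw [h.1] at this; exact absurd this (Finset.notMem_empty _)
      · exact hc₁out t (by omega)
    have h2 : ∀ t, c₂ t = 0 := by
      intro t
      by_cases ht : a ≤ t ∧ t ≤ b + 1
      · by_contra hct
        have : t ∈ S₂ := Finset.mem_filter.mpr ⟨Finset.mem_Icc.mpr ht, hct⟩
        rw [h.2] at this; exact absurd this (Finset.notMem_empty _)
      · exact hc₂out t (by omega)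
    -- u and u' vanish by induction from the left end
    have hzero : ∀ n : ℕ, u (a - 1 + n) = 0 ∧ u' (a - 1 + n) = 0 := by
      intro n
      induction n with
      | zero => exact ⟨hu _ (by omega), hu' _ (by omega)⟩
      | succ n ih =>
        have e1 := h1 (a - 1 + (n + 1 : ℕ)); have e2 := h2 (a - 1 + (n + 1 : ℕ))
        simp only [hc₁, hc₂] at e1 e2
        rw [show a - 1 + ((n + 1 : ℕ) : ℤ) - 1 = a - 1 + (n : ℤ) by push_cast; ring] at e1 e2
        rw [ih.1] at e2; rw [ih.2] at e1
        constructor <;> linarith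
    obtain ⟨k, hk⟩ := hne
    have hk' : a ≤ k := by
      by_contra h'
      rcases hk with hk | hk
      · exact hk (hu k (by omega))
      · exact hk (hu' k (by omega))
    have := hzero (k - (a - 1)).toNat
    rw [show a - 1 + ((k - (a - 1)).toNat : ℤ) = k by omega] at this
    rcases hk with hk | hk
    · exact hk this.1
    · exact hk this.2
  -- a helper producing two slots on a nonempty side
  have two : ∀ (c : ℤ → ℤ) (Sc : Finset ℤ), Sc = (Finset.Icc a (b + 1)).filter (fun t => c t ≠ 0) →
      (∀ t, t < a ∨ b + 1 < t → c t = 0) → Sc.Nonempty →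
      ∃ τ₁ τ₂, τ₁ ≠ τ₂ ∧ (a - 2 * q ≤ τ₁ ∧ τ₁ ≤ b + 1) ∧ (a - 2 * q ≤ τ₂ ∧ τ₂ ≤ b + 1) ∧
        ∑ t ∈ Finset.Icc a (b + 1), c t * win f q t (f τ₁) ≠ 0 ∧
        ∑ t ∈ Finset.Icc a (b + 1), c t * win f q t (f τ₂) ≠ 0 := by
    intro c Sc hSc hcout hScne
    set t₀ := Sc.min' hScne with ht₀
    set t₁ := Sc.max' hScne with ht₁
    have hm₀ := Finset.min'_mem Sc hScne; rw [← ht₀, hSc, Finset.mem_filter, Finset.mem_Icc] at hm₀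
    have hm₁ := Finset.max'_mem Sc hScne; rw [← ht₁, hSc, Finset.mem_filter, Finset.mem_Icc] at hm₁
    have h01 : t₀ ≤ t₁ := Finset.min'_le_max' Sc hScne
    have hout : ∀ t, a ≤ t → t ≤ b + 1 → (t < t₀ ∨ t₁ < t) → c t = 0 := by
      intro t h1 h2 h3
      by_contra hct
      have hmem : t ∈ Sc := by rw [hSc]; exact Finset.mem_filter.mpr ⟨Finset.mem_Icc.mpr ⟨h1, h2⟩, hct⟩
      rcases h3 with h3 | h3
      · exact absurd (Finset.min'_le Sc t hmem) (by rw [← ht₀]; omega)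
      · exact absurd (Finset.le_max' Sc t hmem) (by rw [← ht₁]; omega)
    obtain ⟨hne', htop, hbot⟩ := two_slots hf q c t₀ t₁ h01 (by omega) hm₀.2 hm₁.2
    refine ⟨t₁, t₀ - 2 * q, hne', ⟨by omega, by omega⟩, ⟨by omega, by omega⟩, ?_, ?_⟩
    · rwa [charge_sum_restrict q c hm₀.1.1 hm₁.1.2 hout]
    · rwa [charge_sum_restrict q c hm₀.1.1 hm₁.1.2 hout]
  -- the potential, for the one-sided cases
  have hD_cost : ∀ t₀ t₁, a ≤ t₀ → t₁ ≤ b + 1 →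
      ∑ k ∈ Finset.Icc t₀ (t₁ + 1), |u (k - 1) - u' (k - 1)| < 4 * q := by
    intro t₀ t₁ h0 h1
    have hle : ∑ k ∈ Finset.Icc t₀ (t₁ + 1), |u (k - 1) - u' (k - 1)| ≤
        ∑ k ∈ Finset.Icc a (b + 2), (|u (k - 1)| + |u' (k - 1)|) := by
      calc ∑ k ∈ Finset.Icc t₀ (t₁ + 1), |u (k - 1) - u' (k - 1)|
          ≤ ∑ k ∈ Finset.Icc t₀ (t₁ + 1), (|u (k - 1)| + |u' (k - 1)|) :=
            Finset.sum_le_sum fun k _ => abs_sub _ _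
        _ ≤ ∑ k ∈ Finset.Icc a (b + 2), (|u (k - 1)| + |u' (k - 1)|) :=
            Finset.sum_le_sum_of_subset_of_nonneg (Finset.Icc_subset_Icc h0 (by omega))
              (fun k _ _ => by positivity)
    have hshift : ∑ k ∈ Finset.Icc a (b + 2), (|u (k - 1)| + |u' (k - 1)|) =
        ∑ k ∈ Finset.Icc (a - 1) (b + 1), (|u k| + |u' k|) := by
      have hI : Finset.Icc a (b + 2) = (Finset.Icc (a - 1) (b + 1)).map (addRightEmbedding 1) := by
        rw [Finset.map_add_right_Icc]; congr 1 <;> ring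
      rw [hI, Finset.sum_map]
      refine Finset.sum_congr rfl fun k _ => ?_
      simp [addRightEmbedding]
    have hsame : ∑ k ∈ Finset.Icc (a - 1) (b + 1), (|u k| + |u' k|) =
        ∑ k ∈ Finset.Icc a b, (|u k| + |u' k|) := by
      symm
      refine Finset.sum_subset (Finset.Icc_subset_Icc (by omega) (by omega)) fun k hk hnk => ?_
      obtain ⟨h1, h2⟩ := Finset.mem_Icc.mp hk
      rw [Finset.mem_Icc, not_and_or, not_le, not_le] at hnk
      rw [hu k (by omega), hu' k (by omega)]; simp
    linarith
  -- one-sided case, generic in which side carries the charge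
  have one : ∀ (c : ℤ → ℤ) (Dp : ℤ → ℤ) (Sc : Finset ℤ),
      Sc = (Finset.Icc a (b + 1)).filter (fun t => c t ≠ 0) →
      (∀ t, t < a ∨ b + 1 < t → c t = 0) → Sc.Nonempty →
      (∀ k, Dp (k + 1) - Dp k = c k) → (∀ k, k ≤ a → Dp k = 0) → (∀ k, b + 1 < k → Dp k = 0) →
      (∀ t₀ t₁, a ≤ t₀ → t₁ ≤ b + 1 → ∑ k ∈ Finset.Icc t₀ (t₁ + 1), |Dp k| < 4 * q) →
      ∃ T : Finset ℤ, T.card = 4 ∧ ∀ τ ∈ T, (a - 2 * q ≤ τ ∧ τ ≤ b + 1) ∧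
        ∑ t ∈ Finset.Icc a (b + 1), c t * win f q t (f τ) ≠ 0 := by
    intro c Dp Sc hSc hcout hScne hDp hDp0 hDp1 hDpcost
    set t₀ := Sc.min' hScne with ht₀
    set t₁ := Sc.max' hScne with ht₁
    have hm₀ := Finset.min'_mem Sc hScne; rw [← ht₀, hSc, Finset.mem_filter, Finset.mem_Icc] at hm₀
    have hm₁ := Finset.max'_mem Sc hScne; rw [← ht₁, hSc, Finset.mem_filter, Finset.mem_Icc] at hm₁
    have h01 : t₀ ≤ t₁ := Finset.min'_le_max' Sc hScne
    have hout : ∀ t, (t < t₀ ∨ t₁ < t) → c t = 0 := by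
      intro t h3
      by_cases hr : a ≤ t ∧ t ≤ b + 1
      · by_contra hct
        have hmem : t ∈ Sc := by
          rw [hSc]; exact Finset.mem_filter.mpr ⟨Finset.mem_Icc.mpr hr, hct⟩
        rcases h3 with h3 | h3
        · exact absurd (Finset.min'_le Sc t hmem) (by rw [← ht₀]; omega)
        · exact absurd (Finset.le_max' Sc t hmem) (by rw [← ht₁]; omega)
      · exact hcout t (by omega)
    -- the potential vanishes left of t₀ and right of t₁
    have hD0 : ∀ k, k ≤ t₀ → Dp k = 0 := by
      intro k hk
      rcases le_or_gt k a with hka | hka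
      · exact hDp0 k hka
      · have : ∀ n : ℕ, (a + n : ℤ) ≤ t₀ → Dp (a + n) = 0 := by
          intro n
          induction n with
          | zero => intro _; simpa using hDp0 a le_rfl
          | succ n ih =>
            intro hn
            have h := hDp (a + n)
            rw [hout (a + n) (Or.inl (by push_cast at hn; omega)), ih (by push_cast at hn; omega)] at h
            rw [show a + ((n + 1 : ℕ) : ℤ) = a + n + 1 by push_cast; ring]
            linarith
        have h := this (k - a).toNat (by rw [show a + ((k - a).toNat : ℤ) = k by omega]; exact hk)
        rwa [show a + ((k - a).toNat : ℤ) = k by omega] at h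
    have hD1 : ∀ k, t₁ < k → Dp k = 0 := by
      intro k hk
      rcases lt_or_ge (b + 1) k with hkb | hkb
      · exact hDp1 k hkb
      · have : ∀ n : ℕ, t₁ < b + 2 - n → Dp (b + 2 - n) = 0 := by
          intro n
          induction n with
          | zero => intro _; simpa using hDp1 (b + 2) (by omega)
          | succ n ih =>
            intro hn
            have h := hDp (b + 2 - ((n + 1 : ℕ) : ℤ))
            rw [show b + 2 - ((n + 1 : ℕ) : ℤ) + 1 = b + 2 - (n : ℤ) by push_cast; ring,
              ih (by push_cast at hn; omega),
              hout _ (Or.inr (by push_cast at hn ⊢; omega))] at h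
            linarith
        have h := this (b + 2 - k).toNat (by rw [show b + 2 - ((b + 2 - k).toNat : ℤ) = k by omega]; exact hk)
        rwa [show b + 2 - ((b + 2 - k).toNat : ℤ) = k by omega] at h
    obtain ⟨T, hT, hTslots⟩ := four_slots_of_potential hf q hq c Dp t₀ t₁ h01 hm₀.2 hm₁.2 hout hDp
      hD0 hD1 (hDpcost t₀ t₁ hm₀.1.1 hm₁.1.2)
    refine ⟨T, hT, fun τ hτ => ?_⟩
    have hsl := hTslots τ hτ
    refine ⟨?_, ?_⟩
    · by_contra hr
      apply hsl
      exact charge_sum_apply_born_eq_zero hf q c t₀ t₁ τ (by omega)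
    · rw [charge_sum_restrict q c hm₀.1.1 hm₁.1.2 (fun t _ _ h3 => hout t h3)]; exact hsl
  -- case analysis on which sides are charged
  rcases hS with hS₁ | hS₂
  · by_cases hS₂ : S₂.Nonempty
    · -- both sides: two slots each
      obtain ⟨τ₁, τ₂, h12, hr1, hr2, hs1, hs2⟩ := two c₁ S₁ rfl hc₁out hS₁
      obtain ⟨σ₁, σ₂, g12, gr1, gr2, gs1, gs2⟩ := two c₂ S₂ rfl hc₂out hS₂
      refine ⟨{(true, τ₁), (true, τ₂), (false, σ₁), (false, σ₂)}, ?_, ?_⟩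
      · have n1 : (true, τ₁) ∉ ({(true, τ₂), (false, σ₁), (false, σ₂)} : Finset (Bool × ℤ)) := by
          simp [h12]
        have n2 : (true, τ₂) ∉ ({(false, σ₁), (false, σ₂)} : Finset (Bool × ℤ)) := by simp
        have n3 : ((false, σ₁) : Bool × ℤ) ≠ (false, σ₂) := by simp [g12]
        rw [Finset.card_insert_of_notMem n1, Finset.card_insert_of_notMem n2, Finset.card_pair n3]
      · intro x hx
        simp only [Finset.mem_insert, Finset.mem_singleton] at hx
        rcases hx with rfl | rfl | rfl | rfl
        · exact ⟨hr1, by simpa using hs1⟩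
        · exact ⟨hr2, by simpa using hs2⟩
        · exact ⟨gr1, by simpa using gs1⟩
        · exact ⟨gr2, by simpa using gs2⟩
    · -- only side 1: potential D k = u (k-1) - u' (k-1)
      rw [Finset.not_nonempty_iff_eq_empty] at hS₂
      have hc₂z : ∀ t, c₂ t = 0 := by
        intro t
        by_cases ht : a ≤ t ∧ t ≤ b + 1
        · by_contra hct
          have : t ∈ S₂ := Finset.mem_filter.mpr ⟨Finset.mem_Icc.mpr ht, hct⟩
          rw [hS₂] at this; exact absurd this (Finset.notMem_empty _)
        · exact hc₂out t (by omega)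
      obtain ⟨T, hT, hTs⟩ := one c₁ (fun k => u (k - 1) - u' (k - 1)) S₁ rfl hc₁out hS₁
        (fun k => by
          have := hc₂z k; simp only [hc₂] at this; simp only [hc₁, add_sub_cancel_right]; linarith)
        (fun k hk => by show u (k - 1) - u' (k - 1) = 0; rw [hu _ (by omega), hu' _ (by omega), sub_zero])
        (fun k hk => by show u (k - 1) - u' (k - 1) = 0; rw [hu _ (by omega), hu' _ (by omega), sub_zero])
        (fun t₀ t₁ h0 h1 => hD_cost t₀ t₁ h0 h1)
      refine ⟨T.map ⟨fun τ => (true, τ), fun x y h => by simpa using h⟩, by rw [Finset.card_map, hT], ?_⟩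
      intro x hx
      obtain ⟨τ, hτ, rfl⟩ := Finset.mem_map.mp hx
      exact ⟨(hTs τ hτ).1, by simpa using (hTs τ hτ).2⟩
  · by_cases hS₁ : S₁.Nonempty
    · obtain ⟨τ₁, τ₂, h12, hr1, hr2, hs1, hs2⟩ := two c₁ S₁ rfl hc₁out hS₁
      obtain ⟨σ₁, σ₂, g12, gr1, gr2, gs1, gs2⟩ := two c₂ S₂ rfl hc₂out hS₂
      refine ⟨{(true, τ₁), (true, τ₂), (false, σ₁), (false, σ₂)}, ?_, ?_⟩
      · have n1 : (true, τ₁) ∉ ({(true, τ₂), (false, σ₁), (false, σ₂)} : Finset (Bool × ℤ)) := by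
          simp [h12]
        have n2 : (true, τ₂) ∉ ({(false, σ₁), (false, σ₂)} : Finset (Bool × ℤ)) := by simp
        have n3 : ((false, σ₁) : Bool × ℤ) ≠ (false, σ₂) := by simp [g12]
        rw [Finset.card_insert_of_notMem n1, Finset.card_insert_of_notMem n2, Finset.card_pair n3]
      · intro x hx
        simp only [Finset.mem_insert, Finset.mem_singleton] at hx
        rcases hx with rfl | rfl | rfl | rfl
        · exact ⟨hr1, by simpa using hs1⟩
        · exact ⟨hr2, by simpa using hs2⟩
        · exact ⟨gr1, by simpa using gs1⟩
        · exact ⟨gr2, by simpa using gs2⟩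
    · -- only side 2: potential D' k = u' (k-1) - u (k-1)
      rw [Finset.not_nonempty_iff_eq_empty] at hS₁
      have hc₁z : ∀ t, c₁ t = 0 := by
        intro t
        by_cases ht : a ≤ t ∧ t ≤ b + 1
        · by_contra hct
          have : t ∈ S₁ := Finset.mem_filter.mpr ⟨Finset.mem_Icc.mpr ht, hct⟩
          rw [hS₁] at this; exact absurd this (Finset.notMem_empty _)
        · exact hc₁out t (by omega)
      obtain ⟨T, hT, hTs⟩ := one c₂ (fun k => u' (k - 1) - u (k - 1)) S₂ rfl hc₂out hS₂
        (fun k => by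
          have := hc₁z k; simp only [hc₁] at this; simp only [hc₂, add_sub_cancel_right]; linarith)
        (fun k hk => by show u' (k - 1) - u (k - 1) = 0; rw [hu _ (by omega), hu' _ (by omega), sub_zero])
        (fun k hk => by show u' (k - 1) - u (k - 1) = 0; rw [hu _ (by omega), hu' _ (by omega), sub_zero])
        (fun t₀ t₁ h0 h1 => by
          have := hD_cost t₀ t₁ h0 h1
          calc ∑ k ∈ Finset.Icc t₀ (t₁ + 1), |u' (k - 1) - u (k - 1)|
              = ∑ k ∈ Finset.Icc t₀ (t₁ + 1), |u (k - 1) - u' (k - 1)| :=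
                Finset.sum_congr rfl fun k _ => abs_sub_comm _ _
            _ < 4 * q := this)
      refine ⟨T.map ⟨fun τ => (false, τ), fun x y h => by simpa using h⟩, by rw [Finset.card_map, hT], ?_⟩
      intro x hx
      obtain ⟨τ, hτ, rfl⟩ := Finset.mem_map.mp hx
      exact ⟨(hTs τ hτ).1, by simpa using (hTs τ hτ).2⟩

end Summit.ValiantsHypothesis.ValiantsHypothesis.Theorems.PeelingLemmaWindow
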